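import Mathlib
import Summits.ValiantsHypothesis.ValiantsHypothesis.Theorems.BarrierLeverUniversalCertificateCapacityBarrier

/-!
# Route BarrierLever — capacity barrier, instance 3: PRODUCT-STATE witnesses and TWO-STATE doors

Support file (`--supports stmt-ValiantsHypothesis-19717`; cell valiant-natproofs, rung V4, 𝒟-side; prover
seat val-np-p3 gen 4). Definition-free, cone-free (imports `Mathlib` and the template file
`…UniversalCertificateCapacityBarrier` only). Companion of `CapacityBarrier.exists_dead_layout`.

A PRODUCT STATE on `h` sites is a witness `∏_a q_a(x_a, y_{π a})` with bilinear site factors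
`q_a = τ_a(0,0) + τ_a(1,0)·x_a + τ_a(0,1)·y_{π a} + τ_a(1,1)·x_a y_{π a}` and a pairing `π`; its layout
kernel is `Φ U W = ∏_a τ_a([a ∈ U], [π a ∈ W])`, and a sum of `S` states («TWO-STATE» doors: `S = 2`;
split-leaves; doors whose leaves are product states) has kernel `Σ_q Φ_q`. We work with the kernels
directly (tables `τ : Fin h → Bool → Bool → ℂ`, pairings `π : Fin h → Fin h`, no polynomial algebra).

**Theorem (`productState_capacity`).** If the `x`-free tables do not vanish (`τ_a(0,b) ≠ 0`), then on
the columns `W ⊆ T` every row of size `≤ m` of a product-state kernel is a linear combination of the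
`Σ_{j ≤ m} C(|T|, j)` functions `g_S(W) = G(W)·[S ⊆ W]` (`S ⊆ T`, `|S| ≤ m`,
`G(W) = ∏_a τ_a(0,[π a ∈ W])`): indeed `Φ U W = G(W)·∏_{a∈U} ρ_a([π a ∈ W])` and each `ρ_a` is affine in
the indicator. Hence (`productStates_capacity_barrier`) a sum of `S` nondegenerate product states has
capacity `≤ S·Σ_{j≤m} C(|T|,j)` and is SINGULAR on every layout with more rows of size `≤ m` against
columns inside `T`; and (`productStates_dead_layout`) if `S·Σ_{j≤m} C(|T|,j) < 2^|T| ≤ Σ_{j≤m} C(h,j)`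
ONE injective layout is dead for ALL such `S`-state families at once. Instance
(`productStates_dead_at_sixteen`): `(m, |T|, h) = (2, 7, 16)`, `r = 128`, every family of `S ≤ 4`
states (`4·29 = 116 < 128 ≤ 137`) — the numerical death of the TWO-STATE / split-leaves doors found by
this seat (ranks `57/100/111` for `2/4/5` generic states) is now a kernel theorem for `S ≤ 4`.
Asymptotically (`|T| = h/3`, `m = h/9`) exponentially many states are needed.

SCOPE: degenerate tables (`τ_a(0,b) = 0`) are excluded (a generic state is nondegenerate); CHOW
products are NOT product states (every form involves all variables) and pass the test numerically.
Nothing here bears on item 19717 itself, crux 14610 or `VP ≠ VNP`.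
-/

set_option linter.dupNamespace false

open Matrix Finset

namespace Summit.ValiantsHypothesis.ValiantsHypothesis.Theorems.BarrierLever.CapacityBarrier

/-! ## Counting the spanning functions: subsets of `T` of size `≤ m` -/

/-- `#{S ⊆ T : |S| ≤ m} = Σ_{k ≤ m} C(|T|, k)`. -/
theorem card_filter_powerset_card_le {α : Type*} [DecidableEq α] (T : Finset α) (m : ℕ) :
    (T.powerset.filter (fun S => S.card ≤ m)).card = ∑ k ∈ Finset.range (m + 1), T.card.choose k := by
  have hunion : T.powerset.filter (fun S => S.card ≤ m) =
      (Finset.range (m + 1)).biUnion (fun k => T.powersetCard k) := by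
    ext S
    simp only [Finset.mem_filter, Finset.mem_powerset, Finset.mem_biUnion, Finset.mem_range,
      Finset.mem_powersetCard]
    constructor
    · rintro ⟨hST, hSm⟩
      exact ⟨S.card, by omega, hST, rfl⟩
    · rintro ⟨k, hk, hST, hSk⟩
      exact ⟨hST, by omega⟩
  rw [hunion, Finset.card_biUnion]
  · exact Finset.sum_congr rfl fun k _ => Finset.card_powersetCard k T
  · intro k _ k' _ hkk'
    exact Finset.disjoint_left.2 fun S h1 h2 =>
      hkk' ((Finset.mem_powersetCard.1 h1).2.symm.trans (Finset.mem_powersetCard.1 h2).2)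

/-- `#{U ⊆ Fin h : |U| ≤ s} = Σ_{k ≤ s} C(h, k)` (the number of available test rows). -/
theorem card_filter_univ_card_le (h s : ℕ) :
    ((Finset.univ : Finset (Finset (Fin h))).filter (fun U => U.card ≤ s)).card =
      ∑ k ∈ Finset.range (s + 1), h.choose k := by
  rw [← Finset.powerset_univ, card_filter_powerset_card_le]
  simp

/-! ## One product state: capacity `Σ_{j≤m} C(|T|, j)` on rows of size `≤ m` -/

/-- The site ratio `ρ_a(b) = τ_a(1,b)/τ_a(0,b)` is affine in the indicator of `b`. -/
theorem ratio_affine {h : ℕ} (τ : Fin h → Bool → Bool → ℂ) (a : Fin h) (P : Prop) [Decidable P] :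
    τ a true (decide P) / τ a false (decide P) =
      τ a true false / τ a false false +
        (τ a true true / τ a false true - τ a true false / τ a false false) *
          (if P then 1 else 0) := by
  by_cases hP : P
  · simp only [hP, decide_true, if_true]; ring
  · simp only [hP, decide_false, if_false]; ring

/-- **Capacity of one product state.** For a nondegenerate table (`τ_a(0,b) ≠ 0`) and any pairing `π`,
every row `U` of size `≤ m` of the product-state kernel `W ↦ ∏_a τ_a([a∈U],[π a ∈ W])` is, on the
columns `W ⊆ T`, a linear combination of the functions `W ↦ (∏_a τ_a(0,[π a ∈ W]))·[R ⊆ W]` indexed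
by the subsets `R ⊆ T` of size `≤ m`. -/
theorem productState_capacity {h : ℕ} (π : Fin h → Fin h) (τ : Fin h → Bool → Bool → ℂ)
    (hτ : ∀ a b, τ a false b ≠ 0) (m : ℕ) (T : Finset (Fin h)) (U : Finset (Fin h)) (hU : U.card ≤ m) :
    ∃ c : ↥(T.powerset.filter (fun R => R.card ≤ m)) → ℂ, ∀ W, W ⊆ T →
      (∏ a : Fin h, τ a (decide (a ∈ U)) (decide (π a ∈ W))) =
        ∑ R : ↥(T.powerset.filter (fun R => R.card ≤ m)), c R *
          ((∏ a : Fin h, τ a false (decide (π a ∈ W))) *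
            (if (R : Finset (Fin h)) ⊆ W then 1 else 0)) := by
  classical
  -- the site constants `α_a = ρ_a(0)`, `β_a = ρ_a(1) - ρ_a(0)` and the coefficient of `V ⊆ U`
  let α : Fin h → ℂ := fun a => τ a true false / τ a false false
  let β : Fin h → ℂ := fun a => τ a true true / τ a false true - τ a true false / τ a false false
  let coef : Finset (Fin h) → ℂ := fun V => (∏ a ∈ V, β a) * ∏ a ∈ U \ V, α a
  refine ⟨fun R => ∑ V ∈ U.powerset.filter (fun V => V.image π = (R : Finset (Fin h))), coef V,
    fun W hW => ?_⟩
  set 𝒯 := T.powerset.filter (fun R => R.card ≤ m) with h𝒯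
  set G : ℂ := ∏ a : Fin h, τ a false (decide (π a ∈ W)) with hG
  -- Step 1: `Φ U W = G · ∏_{a∈U} ρ_a([π a ∈ W])`
  have hGU : (∏ a ∈ U, τ a false (decide (π a ∈ W))) ≠ 0 :=
    Finset.prod_ne_zero_iff.2 fun a _ => hτ a _
  have hsplit : (∏ a : Fin h, τ a (decide (a ∈ U)) (decide (π a ∈ W))) =
      G * ∏ a ∈ U, (τ a true (decide (π a ∈ W)) / τ a false (decide (π a ∈ W))) := by
    rw [Finset.prod_div_distrib, hG,
      ← Finset.prod_mul_prod_compl U (fun a => τ a (decide (a ∈ U)) (decide (π a ∈ W))),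
      ← Finset.prod_mul_prod_compl U (fun a => τ a false (decide (π a ∈ W)))]
    have h1 : (∏ a ∈ U, τ a (decide (a ∈ U)) (decide (π a ∈ W))) =
        ∏ a ∈ U, τ a true (decide (π a ∈ W)) :=
      Finset.prod_congr rfl fun a ha => by rw [decide_eq_true ha]
    have h2 : (∏ a ∈ Uᶜ, τ a (decide (a ∈ U)) (decide (π a ∈ W))) =
        ∏ a ∈ Uᶜ, τ a false (decide (π a ∈ W)) :=
      Finset.prod_congr rfl fun a ha => by rw [decide_eq_false (Finset.mem_compl.1 ha)]
    rw [h1, h2]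
    field_simp
  -- Step 2: expand `∏_{a∈U} (β_a [π a ∈ W] + α_a)` over the subsets `V ⊆ U`
  have hexp : (∏ a ∈ U, (τ a true (decide (π a ∈ W)) / τ a false (decide (π a ∈ W)))) =
      ∑ V ∈ U.powerset, coef V * (if V.image π ⊆ W then 1 else 0) := by
    have hρ : ∀ a, τ a true (decide (π a ∈ W)) / τ a false (decide (π a ∈ W)) =
        β a * (if π a ∈ W then 1 else 0) + α a := fun a => by
      rw [ratio_affine τ a (π a ∈ W)]; ring
    rw [Finset.prod_congr rfl fun a _ => hρ a, Finset.prod_add]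
    refine Finset.sum_congr rfl fun V _ => ?_
    rw [Finset.prod_mul_distrib, Finset.prod_boole]
    by_cases hsub : V.image π ⊆ W
    · have hall : ∀ a ∈ V, π a ∈ W := fun a ha => hsub (Finset.mem_image_of_mem π ha)
      rw [if_pos hall, if_pos hsub]
      simp only [coef]; ring
    · have hnall : ¬ ∀ a ∈ V, π a ∈ W := fun hall => hsub (Finset.image_subset_iff.2 hall)
      rw [if_neg hnall, if_neg hsub]
      simp only [coef]; ring
  -- Step 3: a subset `V ⊆ U` whose image is not inside `T` contributes `0` on the columns `W ⊆ T`
  have hvan : ∀ V ∈ U.powerset, V.image π ∉ 𝒯 →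
      coef V * (if V.image π ⊆ W then 1 else 0) * G = 0 := by
    intro V hV hV𝒯
    have hnot : ¬ V.image π ⊆ W := by
      intro hsub
      apply hV𝒯
      rw [h𝒯, Finset.mem_filter, Finset.mem_powerset]
      refine ⟨hsub.trans hW, le_trans Finset.card_image_le (le_trans ?_ hU)⟩
      exact Finset.card_le_card (Finset.mem_powerset.1 hV)
    rw [if_neg hnot, mul_zero, zero_mul]
  -- Step 4: regroup the sum over `V ⊆ U` by the image `R = π(V) ∈ 𝒯`
  have hR : (∑ R : ↥𝒯, (∑ V ∈ U.powerset.filter (fun V => V.image π = (R : Finset (Fin h))), coef V) *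
      (G * (if (R : Finset (Fin h)) ⊆ W then 1 else 0))) =
      ∑ V ∈ U.powerset.filter (fun V => V.image π ∈ 𝒯),
        coef V * (if V.image π ⊆ W then 1 else 0) * G := by
    rw [Finset.sum_coe_sort 𝒯 (fun R => (∑ V ∈ U.powerset.filter
      (fun V => V.image π = R), coef V) * (G * (if R ⊆ W then 1 else 0)))]
    rw [← Finset.sum_fiberwise_of_maps_to (s := U.powerset.filter (fun V => V.image π ∈ 𝒯)) (t := 𝒯)
      (g := fun V => V.image π) (fun V hV => (Finset.mem_filter.1 hV).2)]
    refine Finset.sum_congr rfl fun R hR𝒯 => ?_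
    rw [Finset.sum_mul]
    have hff : (U.powerset.filter (fun V => V.image π ∈ 𝒯)).filter (fun V => V.image π = R) =
        U.powerset.filter (fun V => V.image π = R) := by
      ext V
      simp only [Finset.mem_filter]
      constructor
      · rintro ⟨⟨hV, -⟩, hVR⟩
        exact ⟨hV, hVR⟩
      · rintro ⟨hV, hVR⟩
        exact ⟨⟨hV, hVR ▸ hR𝒯⟩, hVR⟩
    rw [hff]
    refine Finset.sum_congr rfl fun V hV => ?_
    rw [← (Finset.mem_filter.1 hV).2]
    ring
  rw [hsplit, hexp]
  refine Eq.trans ?_ hR.symm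
  rw [Finset.sum_filter_of_ne (fun V hV hne => by
        by_contra hV𝒯
        exact hne (hvan V hV hV𝒯)), Finset.mul_sum]
  exact Finset.sum_congr rfl fun V _ => by ring

/-! ## Sums of `S` product states (TWO-STATE doors: `S = 2`) -/

/-- **Capacity of a sum of `S` product states**: `S·Σ_{j≤m} C(|T|,j)` on rows of size `≤ m`. -/
theorem productStates_capacity {h S : ℕ} (π : Fin S → Fin h → Fin h)
    (τ : Fin S → Fin h → Bool → Bool → ℂ) (hτ : ∀ q a b, τ q a false b ≠ 0) (m : ℕ)
    (T : Finset (Fin h)) (U : Finset (Fin h)) (hU : U.card ≤ m) :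
    ∃ c : Fin S × ↥(T.powerset.filter (fun R => R.card ≤ m)) → ℂ, ∀ W, W ⊆ T →
      (∑ q : Fin S, ∏ a : Fin h, τ q a (decide (a ∈ U)) (decide (π q a ∈ W))) =
        ∑ t : Fin S × ↥(T.powerset.filter (fun R => R.card ≤ m)), c t *
          ((∏ a : Fin h, τ t.1 a false (decide (π t.1 a ∈ W))) *
            (if (t.2 : Finset (Fin h)) ⊆ W then 1 else 0)) := by
  classical
  choose c hc using fun q => productState_capacity (π q) (τ q) (hτ q) m T U hU
  refine ⟨fun t => c t.1 t.2, fun W hW => ?_⟩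
  rw [Fintype.sum_prod_type]
  exact Finset.sum_congr rfl fun q _ => hc q W hW

/-- **Capacity barrier for product states.** A sum of `S` nondegenerate product states is SINGULAR on
every layout with `r > S·Σ_{j≤m} C(|T|,j)` rows of size `≤ m` and columns inside `T`. -/
theorem productStates_capacity_barrier {h S r : ℕ} (π : Fin S → Fin h → Fin h)
    (τ : Fin S → Fin h → Bool → Bool → ℂ) (hτ : ∀ q a b, τ q a false b ≠ 0) (m : ℕ)
    (T : Finset (Fin h)) (u w : Fin r → Finset (Fin h)) (hu : ∀ i, (u i).card ≤ m)
    (hw : ∀ j, w j ⊆ T) (hr : S * ∑ k ∈ Finset.range (m + 1), T.card.choose k < r) :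
    (Matrix.of fun i j : Fin r =>
      ∑ q : Fin S, ∏ a : Fin h, τ q a (decide (a ∈ u i)) (decide (π q a ∈ w j))).det = 0 := by
  classical
  refine capacity_barrier_sets
    (fun U W => ∑ q : Fin S, ∏ a : Fin h, τ q a (decide (a ∈ U)) (decide (π q a ∈ W))) m T
    (fun (t : Fin S × ↥(T.powerset.filter (fun R => R.card ≤ m))) W =>
      (∏ a : Fin h, τ t.1 a false (decide (π t.1 a ∈ W))) *
        (if (t.2 : Finset (Fin h)) ⊆ W then 1 else 0))
    (fun U hU => productStates_capacity π τ hτ m T U hU) ?_ u w hu hw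
  rwa [Fintype.card_prod, Fintype.card_fin, Fintype.card_coe, card_filter_powerset_card_le]

/-- **Product-state dead layouts.** If `S·Σ_{j≤m} C(|T|,j) < 2^|T| ≤ Σ_{j≤m} C(h,j)`, ONE injective
layout (`2^|T|` rows of size `≤ m`, the subsets of `T` as columns) is singular for EVERY family of `S`
nondegenerate product states (all pairings, all tables): no door whose leaves are `≤ S` product states
certifies it. -/
theorem productStates_dead_layout {h : ℕ} (S m : ℕ) (T : Finset (Fin h))
    (hT : S * ∑ k ∈ Finset.range (m + 1), T.card.choose k < 2 ^ T.card)
    (hh : 2 ^ T.card ≤ ∑ k ∈ Finset.range (m + 1), h.choose k) :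
    ∃ u w : Fin (2 ^ T.card) → Finset (Fin h), Function.Injective u ∧ Function.Injective w ∧
      (∀ i, (u i).card ≤ m) ∧ (∀ j, w j ⊆ T) ∧
      ∀ (π : Fin S → Fin h → Fin h) (τ : Fin S → Fin h → Bool → Bool → ℂ),
        (∀ q a b, τ q a false b ≠ 0) →
        (Matrix.of fun i j : Fin (2 ^ T.card) =>
          ∑ q : Fin S, ∏ a : Fin h, τ q a (decide (a ∈ u i)) (decide (π q a ∈ w j))).det = 0 := by
  obtain ⟨u, w, huinj, hwinj, hu, hw⟩ :=
    exists_injective_layout m T (by rwa [card_filter_univ_card_le])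
  exact ⟨u, w, huinj, hwinj, hu, hw, fun π τ hτ =>
    productStates_capacity_barrier π τ hτ m T u w hu hw hT⟩

/-- **TWO-STATE (and `≤ 4`-state) doors die at `(m, |T|, h) = (2, 7, 16)`, `r = 128`:**
`S·(1 + 7 + 21) = 29·S < 128 ≤ 1 + 16 + 120 = 137` for `S ≤ 4`. One injective layout of `128` rows of
size `≤ 2` in `Fin 16` against the `128` subsets of a `7`-block is singular for every sum of `≤ 4`
nondegenerate product states. -/
theorem productStates_dead_at_sixteen (S : ℕ) (hS : S ≤ 4) :
    ∃ u w : Fin (2 ^ ((Finset.univ : Finset (Fin 7)).map (Fin.castLEEmb (by norm_num : 7 ≤ 16))).card) →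
      Finset (Fin 16), Function.Injective u ∧ Function.Injective w ∧
      (∀ i, (u i).card ≤ 2) ∧
      (∀ j, w j ⊆ (Finset.univ : Finset (Fin 7)).map (Fin.castLEEmb (by norm_num : 7 ≤ 16))) ∧
      ∀ (π : Fin S → Fin 16 → Fin 16) (τ : Fin S → Fin 16 → Bool → Bool → ℂ),
        (∀ q a b, τ q a false b ≠ 0) →
        (Matrix.of fun i j => ∑ q : Fin S, ∏ a : Fin 16,
          τ q a (decide (a ∈ u i)) (decide (π q a ∈ w j))).det = 0 := by
  refine productStates_dead_layout S 2 _ ?_ ?_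
  · simp only [Finset.card_map, Finset.card_univ, Fintype.card_fin, Finset.sum_range_succ,
      Finset.sum_range_zero]
    norm_num [Nat.choose]
    omega
  · simp only [Finset.card_map, Finset.card_univ, Fintype.card_fin, Finset.sum_range_succ,
      Finset.sum_range_zero]
    norm_num [Nat.choose]

end Summit.ValiantsHypothesis.ValiantsHypothesis.Theorems.BarrierLever.CapacityBarrier
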